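import Literature.Combinatorics.Optimization.TracialDesigns
import HarnessLib

/-!
# Cell pnp-psdrank, route `ChebyshevTracialDesign`: dimension one — psd rectangles of dimension `1` are exactly the
# tight-free 0/1 rectangles

The route's vocabulary file states informally that for `r = 1` the tight-orthogonal psd rectangles
(`Literature.Combinatorics.Optimization.IsPsdRect`: `0 ⪯ X_U, Y_M ⪯ I`, `X_U Y_M = 0` when `cc U M = 1`) "are the fractional
rectangles avoiding `Q_1`" and that the `r = 1` shadow of the tracial decay is Rothvoß's rectangle bound
(`RectangleDecayBal`). Kernel version:
* `sum_box_le_rectangle` — a bilinear form `Σ W(a,b) x_a y_b` over `[0,1]`-boxes with `x_a y_b = 0` on a set of forbidden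
  pairs is at most its value on some 0/1 rectangle `A × B` containing no forbidden pair (greedy rounding, one side at a time);
* `tracialValueLEAt_one_iff` — `TracialValueLEAt W γ 1 ↔ ∀ tight-free rectangles A × B, Σ_{A×B} W ≤ γ`;
* `rectangleDecayBal_iff_tracial_one` — the classical shadow `RectangleDecayBal a B` is literally the dimension-`1`
  instance of the tracial decay shape.
So the crux's `r = 1` case (planner p1's plan-only stub `stub_rung_r1Exp`) is a statement about 0/1 rectangles avoiding `Q_1`,
the setting of Rothvoß's Lemma 6/7. WHAT THIS IS NOT: no decay is proved here. Supports crux stmt-PneNP-19878 (API).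
-/

set_option linter.dupNamespace false -- `Summit.PneNP.PneNP.…`: summit = sub-problem (D-0017)

noncomputable section

open scoped Classical MatrixOrder

namespace Summit.PneNP.PneNP.Theorems.ChebyshevTracialDesignDimensionOne

open Finset Matrix Literature.Barriers.PneNP Literature.Combinatorics.Optimization

/-! ### §1 Bilinear forms on boxes with forbidden pairs are maximised at admissible 0/1 rectangles -/

section Box

variable {α β : Type} [Fintype α] [Fintype β]

/-- One-sided greedy rounding: for `x ∈ [0,1]^α` and any coefficients `c`, the 0/1 vector `1[x_a > 0 ∧ c_a > 0]` does at
least as well: `Σ c_a x_a ≤ Σ_{a : x_a > 0, c_a > 0} c_a`. -/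
theorem sum_mul_le_sum_filter (c x : α → ℝ) (hx : ∀ a, 0 ≤ x a ∧ x a ≤ 1) :
    ∑ a, c a * x a ≤ ∑ a ∈ univ.filter (fun a => 0 < x a ∧ 0 < c a), c a := by
  rw [sum_filter]
  refine sum_le_sum fun a _ => ?_
  split_ifs with h
  · have := mul_le_mul_of_nonneg_left (hx a).2 h.2.le
    linarith
  · push Not at h
    by_cases hxa : 0 < x a
    · exact le_trans (mul_nonpos_of_nonpos_of_nonneg (h hxa) (hx a).1) le_rfl
    · have : x a = 0 := le_antisymm (not_lt.1 hxa) (hx a).1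
      simp [this]

/-- **Rounding lemma.** If `x ∈ [0,1]^α`, `y ∈ [0,1]^β` and `x_a y_b = 0` on every forbidden pair, then
`Σ_{a,b} W(a,b) x_a y_b ≤ Σ_{a ∈ A} Σ_{b ∈ B} W(a,b)` for some 0/1 rectangle `A × B` containing no forbidden pair. -/
theorem sum_box_le_rectangle (W : α → β → ℝ) (T : α → β → Prop) (x : α → ℝ) (y : β → ℝ)
    (hx : ∀ a, 0 ≤ x a ∧ x a ≤ 1) (hy : ∀ b, 0 ≤ y b ∧ y b ≤ 1) (hT : ∀ a b, T a b → x a * y b = 0) :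
    ∃ (A : Finset α) (B : Finset β), (∀ a ∈ A, ∀ b ∈ B, ¬ T a b) ∧
      ∑ a, ∑ b, W a b * (x a * y b) ≤ ∑ a ∈ A, ∑ b ∈ B, W a b := by
  -- round `x`
  set c : α → ℝ := fun a => ∑ b, W a b * y b with hc
  set A : Finset α := univ.filter (fun a => 0 < x a ∧ 0 < c a) with hA
  have h1 : ∑ a, ∑ b, W a b * (x a * y b) ≤ ∑ a ∈ A, c a := by
    have : ∑ a, ∑ b, W a b * (x a * y b) = ∑ a, c a * x a := by
      refine sum_congr rfl fun a _ => ?_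
      rw [hc]; dsimp only; rw [sum_mul]
      exact sum_congr rfl fun b _ => by ring
    rw [this]
    exact sum_mul_le_sum_filter c x hx
  -- round `y` against the 0/1 vector `1_A`
  set d : β → ℝ := fun b => ∑ a ∈ A, W a b with hd
  set B : Finset β := univ.filter (fun b => 0 < y b ∧ 0 < d b) with hB
  have h2 : ∑ a ∈ A, c a ≤ ∑ b ∈ B, d b := by
    have : ∑ a ∈ A, c a = ∑ b, d b * y b := by
      rw [hd]; dsimp only
      rw [hc]; dsimp only
      rw [sum_comm]
      exact sum_congr rfl fun b _ => by rw [sum_mul]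
    rw [this]
    exact sum_mul_le_sum_filter d y hy
  refine ⟨A, B, fun a ha b hb hab => ?_, ?_⟩
  · have hxa : 0 < x a := ((mem_filter.1 ha).2).1
    have hyb : 0 < y b := ((mem_filter.1 hb).2).1
    have := hT a b hab
    rcases mul_eq_zero.1 this with h | h
    · exact absurd h hxa.ne'
    · exact absurd h hyb.ne'
  · calc ∑ a, ∑ b, W a b * (x a * y b) ≤ ∑ a ∈ A, c a := h1
      _ ≤ ∑ b ∈ B, d b := h2
      _ = ∑ a ∈ A, ∑ b ∈ B, W a b := by rw [hd]; dsimp only; rw [sum_comm]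

end Box

/-! ### §2 Dimension-one psd rectangles -/

variable {n : ℕ}

/-- The `1 × 1` matrix with entry `c`. -/
theorem posSemidef_smul_one {c : ℝ} (hc : 0 ≤ c) : (c • (1 : Matrix (Fin 1) (Fin 1) ℝ)).PosSemidef :=
  PosSemidef.one.smul hc

/-- A 0/1 rectangle avoiding the tight pairs is a psd rectangle of dimension `1`. -/
theorem isPsdRect_indicator (A : Finset (OddSet n)) (B : Finset (PMatch n))
    (hAB : ∀ U ∈ A, ∀ M ∈ B, cc U M ≠ 1) :
    IsPsdRect (fun U => (if U ∈ A then (1 : ℝ) else 0) • (1 : Matrix (Fin 1) (Fin 1) ℝ))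
      (fun M => (if M ∈ B then (1 : ℝ) else 0) • (1 : Matrix (Fin 1) (Fin 1) ℝ)) := by
  refine ⟨fun U => ⟨posSemidef_smul_one (by split_ifs <;> norm_num), ?_⟩,
    fun M => ⟨posSemidef_smul_one (by split_ifs <;> norm_num), ?_⟩, fun U M hcc => ?_⟩
  · have : (1 : Matrix (Fin 1) (Fin 1) ℝ) - (if U ∈ A then (1 : ℝ) else 0) • (1 : Matrix (Fin 1) (Fin 1) ℝ) =
        (1 - (if U ∈ A then (1 : ℝ) else 0)) • (1 : Matrix (Fin 1) (Fin 1) ℝ) := by rw [sub_smul, one_smul]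
    rw [this]; exact posSemidef_smul_one (by split_ifs <;> norm_num)
  · have : (1 : Matrix (Fin 1) (Fin 1) ℝ) - (if M ∈ B then (1 : ℝ) else 0) • (1 : Matrix (Fin 1) (Fin 1) ℝ) =
        (1 - (if M ∈ B then (1 : ℝ) else 0)) • (1 : Matrix (Fin 1) (Fin 1) ℝ) := by rw [sub_smul, one_smul]
    rw [this]; exact posSemidef_smul_one (by split_ifs <;> norm_num)
  · rw [smul_mul_smul, Matrix.one_mul]
    have : (if U ∈ A then (1 : ℝ) else 0) * (if M ∈ B then (1 : ℝ) else 0) = 0 := by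
      by_cases hU : U ∈ A
      · by_cases hM : M ∈ B
        · exact absurd hcc (hAB U hU M hM)
        · simp [hM]
      · simp [hU]
    rw [this, zero_smul]

/-- **Dimension one = rectangles.** `TracialValueLEAt W γ 1` holds iff every 0/1 rectangle avoiding the tight pairs has
`W`-mass at most `γ`. -/
theorem tracialValueLEAt_one_iff (W : OddSet n → PMatch n → ℝ) (γ : ℝ) :
    TracialValueLEAt W γ 1 ↔
      ∀ (A : Finset (OddSet n)) (B : Finset (PMatch n)), (∀ U ∈ A, ∀ M ∈ B, cc U M ≠ 1) →
        ∑ U ∈ A, ∑ M ∈ B, W U M ≤ γ := by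
  constructor
  · intro h A B hAB
    have hv := h _ _ (isPsdRect_indicator A B hAB)
    rw [Nat.cast_one, div_one] at hv
    have hval : ∑ U, ∑ M, W U M *
        (((if U ∈ A then (1 : ℝ) else 0) • (1 : Matrix (Fin 1) (Fin 1) ℝ)) *
          ((if M ∈ B then (1 : ℝ) else 0) • (1 : Matrix (Fin 1) (Fin 1) ℝ))).trace =
        ∑ U ∈ A, ∑ M ∈ B, W U M := by
      rw [← sum_filter_add_sum_filter_not univ (fun U => U ∈ A)]
      have hzero : ∑ U ∈ univ.filter (fun U => ¬ U ∈ A), ∑ M, W U M *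
          (((if U ∈ A then (1 : ℝ) else 0) • (1 : Matrix (Fin 1) (Fin 1) ℝ)) *
            ((if M ∈ B then (1 : ℝ) else 0) • (1 : Matrix (Fin 1) (Fin 1) ℝ))).trace = 0 :=
        sum_eq_zero fun U hU => by
          have hU : U ∉ A := (mem_filter.1 hU).2
          simp [hU]
      rw [hzero, add_zero, filter_mem_eq_inter, univ_inter]
      refine sum_congr rfl fun U hU => ?_
      rw [← sum_filter_add_sum_filter_not univ (fun M => M ∈ B)]
      have hzero' : ∑ M ∈ univ.filter (fun M => ¬ M ∈ B), W U M *
          (((if U ∈ A then (1 : ℝ) else 0) • (1 : Matrix (Fin 1) (Fin 1) ℝ)) *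
            ((if M ∈ B then (1 : ℝ) else 0) • (1 : Matrix (Fin 1) (Fin 1) ℝ))).trace = 0 :=
        sum_eq_zero fun M hM => by
          have hM : M ∉ B := (mem_filter.1 hM).2
          simp [hM]
      rw [hzero', add_zero, filter_mem_eq_inter, univ_inter]
      refine sum_congr rfl fun M hM => ?_
      simp [hU, hM]
    linarith [hval]
  · intro h X Y hXY
    rw [Nat.cast_one, div_one]
    -- entries of the `1 × 1` factors
    set x : OddSet n → ℝ := fun U => X U 0 0 with hx
    set y : PMatch n → ℝ := fun M => Y M 0 0 with hy
    have hx01 : ∀ U, 0 ≤ x U ∧ x U ≤ 1 := fun U => by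
      refine ⟨(hXY.1 U).1.diag_nonneg, ?_⟩
      have := (hXY.1 U).2.diag_nonneg (i := 0)
      simp only [Matrix.sub_apply, one_apply_eq] at this
      rw [hx]; dsimp only; linarith
    have hy01 : ∀ M, 0 ≤ y M ∧ y M ≤ 1 := fun M => by
      refine ⟨(hXY.2.1 M).1.diag_nonneg, ?_⟩
      have := (hXY.2.1 M).2.diag_nonneg (i := 0)
      simp only [Matrix.sub_apply, one_apply_eq] at this
      rw [hy]; dsimp only; linarith
    have htr : ∀ U M, (X U * Y M).trace = x U * y M := fun U M => by
      rw [trace_fin_one, mul_apply, Fin.sum_univ_one]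
    have hT : ∀ U M, cc U M = 1 → x U * y M = 0 := fun U M hcc => by
      rw [← htr, hXY.2.2 U M hcc, trace_zero]
    obtain ⟨A, B, hAB, hle⟩ := sum_box_le_rectangle W (fun U M => cc U M = 1) x y hx01 hy01 hT
    calc ∑ U, ∑ M, W U M * (X U * Y M).trace = ∑ U, ∑ M, W U M * (x U * y M) := by
          simp_rw [htr]
      _ ≤ ∑ U ∈ A, ∑ M ∈ B, W U M := hle
      _ ≤ γ := h A B hAB

/-! ### §3 The classical shadow is the dimension-one tracial decay -/

/-- **`RectangleDecayBal a B` is literally the `r = 1` instance of the tracial decay shape.** -/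
theorem rectangleDecayBal_iff_tracial_one (a B : ℝ) :
    RectangleDecayBal a B ↔
      ∃ n₁ : ℕ, ∀ n : ℕ, n₁ ≤ n → Even n → ∀ (t : ℕ) (C : Finset ℕ) (w : ℕ → ℝ),
        IsBalancedDesign n t (Tq n) (dq n) B C w →
          TracialValueLEAt (levelWeight n t C w) ((n : ℝ) ^ (-(a * (dq n : ℝ)))) 1 := by
  unfold RectangleDecayBal
  constructor
  · rintro ⟨n₁, h⟩
    exact ⟨n₁, fun n hn he t C w hdes => (tracialValueLEAt_one_iff _ _).2 (h n hn he t C w hdes)⟩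
  · rintro ⟨n₁, h⟩
    exact ⟨n₁, fun n hn he t C w hdes => (tracialValueLEAt_one_iff _ _).1 (h n hn he t C w hdes)⟩

/-- In particular the dimension-restricted decay `TracialDecayDimBal a B` contains the classical shadow (take `r = 1`;
the budget `1²·n < n^{a·dq n}` holds for large `n`). -/
theorem rectangleDecayBal_of_tracialDecayDimBal {a B : ℝ} (ha : 0 < a) (h : TracialDecayDimBal a B) :
    RectangleDecayBal a B := by
  obtain ⟨n₁, H⟩ := h
  rw [rectangleDecayBal_iff_tracial_one]
  -- the budget `n < n^{a dq n}` for `n` large: `dq n ≥ 2/a` suffices... use `dq n → ∞`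
  obtain ⟨N, hN⟩ : ∃ N : ℕ, ∀ n ≥ N, (1 : ℝ) < a * (dq n : ℝ) := by
    obtain ⟨K, hK⟩ := exists_nat_gt (1 / a)
    refine ⟨(K ^ 2) ^ 2, fun n hn => ?_⟩
    have hdq : K ≤ dq n := by
      rw [dq]
      apply Nat.le_sqrt.2
      apply Nat.le_sqrt.2
      simpa [sq] using hn
    have hK' : (K : ℝ) ≤ dq n := by exact_mod_cast hdq
    have : 1 / a < dq n := lt_of_lt_of_le hK hK'
    rwa [div_lt_iff₀ ha, mul_comm] at this
  refine ⟨max (max n₁ N) 2, fun n hn he t C w hdes => H n (le_trans (le_max_left _ _ |>.trans' (le_max_left _ _)) hn)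
    he t C w hdes 1 one_pos ?_⟩
  have hn2 : (2 : ℝ) ≤ n := by exact_mod_cast le_trans (le_max_right _ _) hn
  have hnN : N ≤ n := le_trans (le_trans (le_max_right _ _) (le_max_left _ _)) hn
  have h1 : (1 : ℝ) < a * (dq n : ℝ) := hN n hnN
  rw [Nat.cast_one, one_pow, one_mul]
  calc (n : ℝ) = (n : ℝ) ^ (1 : ℝ) := (Real.rpow_one _).symm
    _ < (n : ℝ) ^ (a * (dq n : ℝ)) := Real.rpow_lt_rpow_of_exponent_lt (by linarith) h1

end Summit.PneNP.PneNP.Theorems.ChebyshevTracialDesignDimensionOne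

end
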